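import Summits.ResolutionOfSingularities.ResolutionOfSingularities.Theorems.FrobeniusClosingPatchingRelPerfectCoreRungClosure
import Literature.AlgebraicGeometry.Resolution.ArithmeticalThreefoldsBlowupFormDimThree
import Literature.AlgebraicGeometry.Resolution.RegularCentreBlowupSeqIntegral
import Literature.AlgebraicGeometry.Resolution.StrictTransformOpenImmersion
import Literature.AlgebraicGeometry.Resolution.AffineBlowupUnique
import HarnessLib

/-!
# Crux `PatchingRelPerfect` (stmt-ResolutionOfSingularities-16161), chain w52 — programme r-d1,
# piece D5: CONTRACTION of a closed-point tower (`TowerContraction` of plan-1's targets D)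

[OURS · L1 W5.2 · rung tool] CHAIN.md v1.4a §2 (row stub-3), typed target `TowerContraction` of
`ChainW52TargetsD.lean` (adopted by content, same binder shape): let `S` be a regular local ring,
`I ≠ 0` an ideal, and `g : X ⟶ Spec S` a blowing up along an ideal sheaf `K` cosupported in the
closed point (which every composite of blowing ups at centres over the closed point is, Stacks
080B), with `X` regular and `I𝒪_X` locally principal.  Then `I` is in the companion class `𝒞` of
W2 / r1d (the hypothesis shape of `atomConclusion_of_companion'`): `K = Q~` for an ideal `Q` of
`S` (`affineBlowup.exists_eq_idealSheaf'`), `V(Q) ⊆ {𝔪}` gives `𝔪ᵐ ⊆ Q` (Noetherian radical),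
`X` is integral so the locally principal non-zero `I𝒪_X` is an effective Cartier divisor
(`IsLocallyPrincipal.isEffectiveCartier_of_ne_bot`, `IsBlowup.comap_ne_bot`), and then `g` is also
the blowing up along `(I Q)~` (Stacks 080A/080B, `IsBlowup.mul_of_isEffectiveCartier_comap`).  The
degenerate base (`S` a field) gets the companion `⊤`.  PROVED: `towerContraction` (the target's
statement verbatim) and the corollary `atomConclusion_of_tower` (the blow-up-form core's conclusion
for every `T = Bl_I Spec S` from such a tower).  Nothing here is a statement of the manuscript under
review.

## References

* The Stacks Project, Tags 080A, 080B, 01WR. [StacksProject]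
-/

-- `Summit.<Summit>.<Sub>.Theorems` with `Sub = Summit` (single-conjunct summit, D-0017)
set_option linter.dupNamespace false

noncomputable section

open CategoryTheory CategoryTheory.Limits AlgebraicGeometry Literature.AlgebraicGeometry.Resolution
open IsLocalRing

namespace Summit.ResolutionOfSingularities.ResolutionOfSingularities.Theorems

universe u

/-- An ideal sheaf `Q~` on `Spec S` cosupported in the closed point of the local ring `S` comes from
an ideal containing a power of `𝔪` (Noetherian `S`). [folklore] -/
theorem exists_pow_maximalIdeal_le_of_support_subset {S : Type u} [CommRing S] [IsLocalRing S]
    [IsNoetherianRing S] (Q : Ideal S)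
    (hK : ((affineBlowup.idealSheaf Q).support : Set (Spec (.of S))) ⊆
      {IsLocalRing.closedPoint S}) :
    ∃ m : ℕ, IsLocalRing.maximalIdeal S ^ m ≤ Q := by
  have hrad : IsLocalRing.maximalIdeal S ≤ Q.radical := by
    intro r hr
    rw [Ideal.radical_eq_sInf, Ideal.mem_sInf]
    rintro P ⟨hQP, hP⟩
    have hmem : (⟨P, hP⟩ : PrimeSpectrum S) ∈
        ((affineBlowup.idealSheaf Q).support : Set (Spec (.of S))) := by
      rw [affineBlowup.support_idealSheaf]
      exact hQP
    have h : (⟨P, hP⟩ : PrimeSpectrum S) = IsLocalRing.closedPoint S := hK hmem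
    have hPm : P = IsLocalRing.maximalIdeal S := congrArg PrimeSpectrum.asIdeal h
    rw [hPm]
    exact hr
  exact Ideal.exists_pow_le_of_le_radical_of_fg hrad (IsNoetherian.noetherian _)

/-- **D5 — contraction of a closed-point tower** (`TowerContraction` of plan-1's
`ChainW52TargetsD.lean`, verbatim binder shape): if `g : X ⟶ Spec S` is a blowing up along an
ideal sheaf cosupported in the closed point of the regular local ring `S`, `X` is regular and
`I𝒪_X` is locally principal (`I ≠ 0`), then `I` has an `𝔪`-primary (or unit) companion `Q` with a
regular blowing up along `(I Q)~` — namely `g` itself (Stacks 080A/080B).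
[cite: StacksProject, Tag 080A] [cite: StacksProject, Tag 080B] -/
theorem towerContraction {S : Type u} [CommRing S] [IsRegularLocalRing S] (I : Ideal S) (hI : I ≠ ⊥)
    (X : Scheme.{u}) (g : X ⟶ Spec (.of S)) (K : (Spec (.of S)).IdealSheafData)
    (hg : IsBlowup g K) (hK : (K.support : Set (Spec (.of S))) ⊆ {IsLocalRing.closedPoint S})
    (hX : Scheme.IsRegular X) (hIp : IsLocallyPrincipal ((affineBlowup.idealSheaf I).comap g)) :
    ∃ (Q : Ideal S) (m : ℕ), IsLocalRing.maximalIdeal S ^ m ≤ Q ∧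
      ∃ (B : Scheme.{u}) (b : B ⟶ Spec (.of S)),
        IsBlowup b (affineBlowup.idealSheaf (I * Q)) ∧ Scheme.IsRegular B := by
  haveI : IsDomain S := isDomain_of_isRegularLocalRing S
  obtain ⟨Q, rfl⟩ := affineBlowup.exists_eq_idealSheaf' K
  obtain ⟨m, hm⟩ := exists_pow_maximalIdeal_le_of_support_subset Q hK
  by_cases hbot : IsLocalRing.maximalIdeal S = ⊥
  · -- `S` is a field: `I = ⊤`, companion `⊤`, the identity blowing up
    have hItop : I = ⊤ := by
      by_contra h
      exact hI (le_bot_iff.mp (hbot ▸ IsLocalRing.le_maximalIdeal h))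
    obtain ⟨B, b, hb⟩ := exists_isBlowup (Spec (.of S)) (affineBlowup.idealSheaf (I * ⊤))
    refine ⟨⊤, 0, by rw [pow_zero, Ideal.one_eq_top], B, b, hb, ?_⟩
    rw [hItop, Ideal.top_mul, affineBlowup.idealSheaf_top] at hb
    haveI : IsIso b := hb.isIso isEffectiveCartier_top
    haveI : IsRegularRing S := isRegularRing_of_isRegularLocalRing S
    haveI : IsRegularRing (CommRingCat.of S) := inferInstanceAs (IsRegularRing S)
    exact SectionAscent.TraceIdeal.isRegular_of_iso (asIso b) (Scheme.isRegular_Spec _)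
  · have hQ : Q ≠ ⊥ := CoreRungClosure.ne_bot_of_pow_maximalIdeal_le hbot hm
    haveI : IsDomain (CommRingCat.of S) := inferInstanceAs (IsDomain S)
    haveI : IsIntegral (Spec (.of S)) := inferInstance
    haveI : IsIntegral X := hg.isIntegral (affineBlowup.idealSheaf_ne_bot hQ)
    have hsupp : (affineBlowup.idealSheaf Q).support ≠ ⊤ := by
      intro h
      have hgen : (⟨⊥, Ideal.isPrime_bot⟩ : PrimeSpectrum S) ∈
          ((affineBlowup.idealSheaf Q).support : Set (Spec (.of S))) := by
        rw [h]; trivial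
      rw [affineBlowup.support_idealSheaf] at hgen
      exact hQ (le_bot_iff.mp fun r hr => hgen hr)
    have hne : (affineBlowup.idealSheaf I).comap g ≠ ⊥ :=
      hg.comap_ne_bot hsupp (affineBlowup.idealSheaf_ne_bot hI)
    refine ⟨Q, m, hm, X, g, ?_, hX⟩
    rw [mul_comm, affineBlowup.idealSheaf_mul]
    exact hg.mul_of_isEffectiveCartier_comap (hIp.isEffectiveCartier_of_ne_bot hne)

/-- **The blow-up-form core's conclusion from a contracting tower**: under the hypotheses of
`towerContraction`, every blowing up `T = Bl_I Spec S` carries a non-zero ideal sheaf cosupported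
in the closed fibre with regular blowing up (`atomConclusion_of_companion'`).
[cite: StacksProject, Tag 080A] -/
theorem atomConclusion_of_tower {S : Type u} [CommRing S] [IsRegularLocalRing S] {I : Ideal S}
    (hI : I ≠ ⊥) {X : Scheme.{u}} {g : X ⟶ Spec (.of S)} {K : (Spec (.of S)).IdealSheafData}
    (hg : IsBlowup g K) (hK : (K.support : Set (Spec (.of S))) ⊆ {IsLocalRing.closedPoint S})
    (hX : Scheme.IsRegular X) (hIp : IsLocallyPrincipal ((affineBlowup.idealSheaf I).comap g))
    (T : Scheme.{u}) (f : T ⟶ Spec (.of S)) (hf : IsBlowup f (affineBlowup.idealSheaf I)) :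
    ∃ (J : T.IdealSheafData) (T' : Scheme.{u}) (π : T' ⟶ T), J ≠ ⊥ ∧
      (∀ t : T, t ∈ J.support → f.base t = IsLocalRing.closedPoint S) ∧
      IsBlowup π J ∧ Scheme.IsRegular T' :=
  atomConclusion_of_companion' hI (towerContraction I hI X g K hg hK hX hIp) T f hf

end Summit.ResolutionOfSingularities.ResolutionOfSingularities.Theorems

end
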